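import Summits.HubbardSuperconductivity.HubbardSuperconductivity.Cruxes.KkBandLift.Lines.KkSubspaceFloor

/-!
# Witness (F3 / BC5) for the rung `KkSubspaceFloor` = `∀ 𝒲, KkFloorOn 𝒲`

The graded family `KkFloorOn 𝒲` at the floor's parameter `𝒲 := sectorSel` (`W ≡ V`) is LITERALLY the
proved seed `Theorems.kkFloorTheorem_proof : Theses.KkFloor.KkFloorTheorem` (item
stmt-HubbardSuperconductivity-10406, seed g1-HubbardSuperconductivity-10406): the two extra
hypotheses of the rung are discarded. rc 0, no `sorry`.
-/

namespace Summit.HubbardSuperconductivity.HubbardSuperconductivity.Cruxes.KkBandLift.SubspaceFloor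

open Summit.HubbardSuperconductivity.HubbardSuperconductivity.Theorems (kkFloorTheorem_proof)

/-- The floor is the top member of the family: `KkFloorOn sectorSel`. -/
theorem kkFloorOn_sectorSel : KkFloorOn sectorSel := by
  intro n _ _ A B V E S d ψ hA hB hBpos hAV hBV hE hψV hψ1 hAψ _hψW _hWinv hd
  exact kkFloorTheorem_proof n A B V E S d ψ hA hB hBpos hAV hBV hE hψV hψ1 hAψ hd

example : KkFloorOn sectorSel := kkFloorOn_sectorSel

end Summit.HubbardSuperconductivity.HubbardSuperconductivity.Cruxes.KkBandLift.SubspaceFloor
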